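import Summits.NavierStokesRegularity.NavierStokesRegularity.Theorems.TypeITraceScarL3.Negative.C1PrimeFalseWithoutNS
import HarnessLib

/-!
# The travelling swirl, part 4: the LOUD-DUST stub minus its Navier–Stokes clause has a kinematic
# counter-model

Negative-lane lemma file of the disprover seat `cdisprove-stmt-NavierStokesRegularity-18385`
(`--supports` the item).  Along the LOUD path `c(t) = ρ(t)e₀`,
`ρ(t) = 4√(−t)·exp((−t)⁻¹(1 + sin (−t)⁻¹))` (part 1), the radius takes EVERY positive value at
arbitrarily late times (`exists_loudRadius_eq`, intermediate values between troughs `4√(−t)` and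
crests `≥ 8(−t)^{−1/2}`), so the travelling swirl (i) exceeds every level on every late shell
`]−δ,0[ × {R < ‖y‖ < A₀R}` — it has NO QUIET SHELL of any ratio `A₀ > 1` (`swirlLoud_isLoud`) — and
(ii) is backward singular at the origin (`swirlLoud_isBackwardSingularPoint`).  With parts 2–3 this
gives `exists_kinematic_loudShellExtinctApex`: a divergence-free `U`, `P = 0`, `G = ∇U` satisfying
(G), (I), (D), (R), (T) of the apex package, LOUD for every ratio, singular at `0`.  Hence the stub
`stub_no_loudShellExtinctApex` of line `annulus-dichotomy` (nsreg-p2 ROUND-26) cannot be proved from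
the kinematic clauses plus its quiet-shell hypothesis `hQA` alone: any proof must use the
Navier–Stokes clause (sw) of the OUTER package.  Not a Navier–Stokes solution; NS regularity is
neither proved nor refuted here. [folklore; AlbrittonBarker2019 §1; KNSS2009 (1.4)]
-/


noncomputable section

set_option linter.dupNamespace false

namespace Summit.NavierStokesRegularity.NavierStokesRegularity.Theorems.TypeITraceScarL3.Negative

open MeasureTheory Set Function Filter Topology Metric TopologicalSpace
open Literature.Analysis.FluidPDE Literature.Analysis.FluidPDE.ParabolicBump
open scoped NNReal ENNReal InnerProductSpace RealInnerProductSpace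

/-! ### The LOUD path: an oscillating radius sweeping every shell at arbitrarily late times -/

/-- `ρ ≥ 0`. [folklore] -/
theorem loudRadius_nonneg (t : ℝ) : 0 ≤ loudRadius t := by
  unfold loudRadius; positivity

/-- `ρ(t) ≥ 4√(−t)`: the travelling swirl stays off the parabolic neighbourhood of the origin. [folklore] -/
theorem four_sqrt_le_loudRadius {t : ℝ} (ht : t < 0) : 4 * Real.sqrt (-t) ≤ loudRadius t := by
  unfold loudRadius
  have h1 : 1 ≤ Real.exp ((-t)⁻¹ * (1 + Real.sin (-t)⁻¹)) := by
    refine Real.one_le_exp ?_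
    exact mul_nonneg (inv_nonneg.2 (by linarith)) (by linarith [Real.neg_one_le_sin (-t)⁻¹])
  have h4 : 0 ≤ 4 * Real.sqrt (-t) := by positivity
  nlinarith

/-- `‖c(t)‖ = ρ(t)`. [folklore] -/
theorem norm_loudPath (t : ℝ) : ‖loudPath t‖ = loudRadius t := by
  rw [loudPath, norm_smul, norm_parasiticDir, mul_one, Real.norm_of_nonneg (loudRadius_nonneg t)]

/-- `‖c(t) + √(−t)e₀‖ = ρ(t) + √(−t)`. [folklore] -/
theorem norm_loudPath_add_peak (t : ℝ) :
    ‖loudPath t + Real.sqrt (-t) • parasiticDir‖ = loudRadius t + Real.sqrt (-t) := by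
  rw [loudPath, ← add_smul, norm_smul, norm_parasiticDir, mul_one,
    Real.norm_of_nonneg (add_nonneg (loudRadius_nonneg t) (Real.sqrt_nonneg _))]

/-- The radius is smooth on `t < 0`. [folklore] -/
theorem contDiffOn_loudRadius {n : ℕ∞} : ContDiffOn ℝ n loudRadius (Iio 0) := by
  have hne : ∀ t ∈ Iio (0 : ℝ), -t ≠ 0 := fun t ht => by
    simp only [mem_Iio] at ht
    linarith
  have h1 : ContDiffOn ℝ n (fun t : ℝ => Real.sqrt (-t)) (Iio 0) := fun t ht =>
    ((Real.contDiffAt_sqrt (hne t ht)).comp t contDiffAt_id.neg).contDiffWithinAt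
  have h2 : ContDiffOn ℝ n (fun t : ℝ => (-t)⁻¹) (Iio 0) := contDiffOn_id.neg.inv hne
  have h3 : ContDiffOn ℝ n (fun t : ℝ => Real.exp ((-t)⁻¹ * (1 + Real.sin (-t)⁻¹))) (Iio 0) :=
    Real.contDiff_exp.comp_contDiffOn
      (h2.mul (contDiffOn_const.add (Real.contDiff_sin.comp_contDiffOn h2)))
  unfold loudRadius
  exact (contDiffOn_const.mul h1).mul h3

/-- The path is smooth on `t < 0`. [folklore] -/
theorem contDiffOn_loudPath {n : ℕ∞} : ContDiffOn ℝ n loudPath (Iio 0) :=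
  contDiffOn_loudRadius.smul contDiffOn_const

/-- **The radius takes every positive value at arbitrarily late times** (intermediate values between
the troughs `ρ = 4√(−t)` at `(−t)⁻¹ = 2πn + 3π/2` and the crests `ρ ≥ 8√((−t)⁻¹)` at
`(−t)⁻¹ = 2πn + π/2`). [folklore] -/
theorem exists_loudRadius_eq {m δ : ℝ} (hm : 0 < m) (hδ : 0 < δ) :
    ∃ t : ℝ, -δ < t ∧ t < 0 ∧ loudRadius t = m := by
  obtain ⟨n, hn⟩ := exists_nat_gt (1 / δ + 16 / m ^ 2 + m ^ 2 / 64)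
  have hπ := Real.pi_gt_three
  set a : ℝ := Real.pi / 2 + (n : ℝ) * (2 * Real.pi) with ha
  set b : ℝ := -(Real.pi / 2) + ((n + 1 : ℕ) : ℝ) * (2 * Real.pi) with hb
  have hn0 : (0 : ℝ) ≤ n := n.cast_nonneg
  have hna : (n : ℝ) < a := by rw [ha]; nlinarith
  have hab : a < b := by rw [ha, hb]; push_cast; nlinarith
  have ha0 : 0 < a := by rw [ha]; positivity
  have hb0 : 0 < b := ha0.trans hab
  have hp1 : (0 : ℝ) < 1 / δ := by positivity
  have hp2 : (0 : ℝ) < 16 / m ^ 2 := by positivity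
  have hp3 : (0 : ℝ) < m ^ 2 / 64 := by positivity
  have hδ' : 1 / δ < a := by linarith
  have hm16 : 16 / m ^ 2 < b := by linarith
  have hm64 : m ^ 2 / 64 < a := by linarith
  have hsa : Real.sin a = 1 := by rw [ha, Real.sin_add_nat_mul_two_pi, Real.sin_pi_div_two]
  have hsb : Real.sin b = -1 := by
    rw [hb, Real.sin_add_nat_mul_two_pi, Real.sin_neg, Real.sin_pi_div_two]
  set t₂ : ℝ := -a⁻¹ with ht₂
  set t₁ : ℝ := -b⁻¹ with ht₁
  have h21 : t₂ ≤ t₁ := by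
    rw [ht₂, ht₁]; exact neg_le_neg ((inv_lt_inv₀ hb0 ha0).2 hab).le
  have ht1neg : t₁ < 0 := by rw [ht₁]; exact neg_neg_of_pos (inv_pos.2 hb0)
  have ht2δ : -δ < t₂ := by
    rw [ht₂, neg_lt_neg_iff, inv_lt_comm₀ ha0 hδ, ← one_div]
    exact hδ'
  have hf1 : loudRadius t₁ = 4 * Real.sqrt b⁻¹ := by
    rw [loudRadius, ht₁, neg_neg, inv_inv, hsb]; simp
  have hf2 : loudRadius t₂ = 4 * Real.sqrt a⁻¹ * Real.exp (2 * a) := by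
    rw [loudRadius, ht₂, neg_neg, inv_inv, hsa, show a * (1 + 1) = 2 * a by ring]
  have hle1 : loudRadius t₁ ≤ m := by
    rw [hf1, Real.sqrt_inv]
    have hsb0 : 0 < Real.sqrt b := Real.sqrt_pos.2 hb0
    rw [mul_inv_le_iff₀ hsb0]
    have h16 : 16 ≤ m ^ 2 * b := by
      have := (div_lt_iff₀ (by positivity : (0 : ℝ) < m ^ 2)).1 hm16
      linarith
    have h4 : Real.sqrt 16 ≤ Real.sqrt (m ^ 2 * b) := Real.sqrt_le_sqrt h16
    rw [show (16 : ℝ) = 4 ^ 2 by norm_num, Real.sqrt_sq (by norm_num), Real.sqrt_mul (sq_nonneg m),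
      Real.sqrt_sq hm.le] at h4
    exact h4
  have hle2 : m ≤ loudRadius t₂ := by
    rw [hf2, Real.sqrt_inv]
    have hsa0 : 0 < Real.sqrt a := Real.sqrt_pos.2 ha0
    have hexp : 2 * a ≤ Real.exp (2 * a) := by linarith [Real.add_one_le_exp (2 * a)]
    have hsqa : m / 8 ≤ Real.sqrt a := by
      rw [← Real.sqrt_sq (by positivity : (0 : ℝ) ≤ m / 8)]
      exact Real.sqrt_le_sqrt (by nlinarith)
    have key : Real.sqrt a * Real.sqrt a = a := Real.mul_self_sqrt ha0.le
    calc m ≤ 8 * Real.sqrt a := by linarith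
      _ = 4 * (Real.sqrt a)⁻¹ * (2 * a) := by
          have h3 : (Real.sqrt a)⁻¹ * a = Real.sqrt a := by
            rw [inv_mul_eq_iff_eq_mul₀ hsa0.ne']; exact key.symm
          linear_combination (-8) * h3
      _ ≤ 4 * (Real.sqrt a)⁻¹ * Real.exp (2 * a) := by gcongr
  have hcont : ContinuousOn loudRadius (Icc t₂ t₁) :=
    (contDiffOn_loudRadius (n := 0)).continuousOn.mono fun t ht => lt_of_le_of_lt ht.2 ht1neg
  obtain ⟨t, ht, hft⟩ := intermediate_value_Icc' h21 hcont ⟨hle1, hle2⟩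
  exact ⟨t, lt_of_lt_of_le ht2δ ht.1, lt_of_le_of_lt ht.2 ht1neg, hft⟩

/-- The shell `{R < ‖y‖ < A R}` is open. [folklore] -/
theorem isOpen_shell (R A : ℝ) :
    IsOpen {y : EuclideanSpace ℝ (Fin 3) | R < ‖y‖ ∧ ‖y‖ < A} :=
  (isOpen_lt continuous_const continuous_norm).inter (isOpen_lt continuous_norm continuous_const)

/-- **LOUD**: the travelling swirl along the loud path has NO quiet shell of any ratio `A₀ > 1` — it is
essentially unbounded on `]−δ, 0[ × {R < ‖y‖ < A₀R}` for every `δ, R > 0`. [folklore] -/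
theorem swirlLoud_isLoud {A₀ : ℝ} (hA : 1 < A₀) (δ : ℝ) (hδ : 0 < δ) (R : ℝ) (hR : 0 < R) (K : ℝ) :
    ¬ (∀ᵐ z ∂(volume.restrict
        (Ioo (-δ) 0 ×ˢ {y : EuclideanSpace ℝ (Fin 3) | R < ‖y‖ ∧ ‖y‖ < A₀ * R})),
          ‖swirlTravel loudPath z.1 z.2‖ ≤ K) := by
  set m : ℝ := (1 + A₀) / 2 * R with hm
  set gap : ℝ := (A₀ - 1) / 2 * R with hgap
  have hm0 : 0 < m := by positivity
  have hgap0 : 0 < gap := by rw [hgap]; exact mul_pos (by linarith) hR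
  have hK1 : 0 < 1 / (2 * (|K| + 1)) := by positivity
  set δ' : ℝ := min δ (min (gap ^ 2) ((1 / (2 * (|K| + 1))) ^ 2)) with hδ'
  have hδ'0 : 0 < δ' := lt_min hδ (lt_min (by positivity) (by positivity))
  obtain ⟨t, ht1, ht2, hft⟩ := exists_loudRadius_eq hm0 hδ'0
  have hnt : 0 < -t := by linarith
  have hσ : 0 < Real.sqrt (-t) := Real.sqrt_pos.2 hnt
  have hδδ : δ' ≤ δ := min_le_left _ _
  have hδg : δ' ≤ gap ^ 2 := (min_le_right _ _).trans (min_le_left _ _)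
  have hδk : δ' ≤ (1 / (2 * (|K| + 1))) ^ 2 := (min_le_right _ _).trans (min_le_right _ _)
  have hg : Real.sqrt (-t) < gap := sqrt_neg_lt_of_lt_sq hgap0 (by linarith)
  have hk : Real.sqrt (-t) < 1 / (2 * (|K| + 1)) := sqrt_neg_lt_of_lt_sq hK1 (by linarith)
  refine swirlTravel_not_ae_le_of_mem (contDiffOn_loudPath (n := 0))
    (isOpen_Ioo.prod (isOpen_shell R (A₀ * R))) (fun z hz => ⟨hz.1.2, mem_univ _⟩)
    (z := (t, loudPath t + Real.sqrt (-t) • parasiticDir)) ⟨⟨by linarith, ht2⟩, ?_⟩ ?_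
  · show R < ‖loudPath t + Real.sqrt (-t) • parasiticDir‖ ∧
      ‖loudPath t + Real.sqrt (-t) • parasiticDir‖ < A₀ * R
    rw [norm_loudPath_add_peak, hft]
    constructor
    · rw [hm]; nlinarith
    · rw [hm]; rw [hgap] at hg; nlinarith
  · show K < ‖swirlTravel loudPath t (loudPath t + Real.sqrt (-t) • parasiticDir)‖
    rw [norm_swirlTravel_peak loudPath ht2]
    exact lt_peak_of_sqrt_lt hσ hk

/-- **The loud travelling swirl is singular at the origin**: the path returns to `ρ(t) = r/2` at
arbitrarily late times. [folklore] -/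
theorem swirlLoud_isBackwardSingularPoint :
    IsBackwardSingularPoint (swirlTravel loudPath) (0 : ℝ × EuclideanSpace ℝ (Fin 3)) := by
  refine swirlTravel_isBackwardSingularPoint (contDiffOn_loudPath (n := 0)) fun r hr N => ?_
  have hN1 : 0 < 1 / (2 * (|N| + 1)) := by positivity
  have hr2 : 0 < r / 2 := by positivity
  set δ' : ℝ := min (r ^ 2) (min ((r / 2) ^ 2) ((1 / (2 * (|N| + 1))) ^ 2)) with hδ'
  have hδ'0 : 0 < δ' := lt_min (by positivity) (lt_min (by positivity) (by positivity))
  obtain ⟨t, ht1, ht2, hft⟩ := exists_loudRadius_eq hr2 hδ'0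
  have hnt : 0 < -t := by linarith
  have hσ : 0 < Real.sqrt (-t) := Real.sqrt_pos.2 hnt
  have hδr : δ' ≤ r ^ 2 := min_le_left _ _
  have hδg : δ' ≤ (r / 2) ^ 2 := (min_le_right _ _).trans (min_le_left _ _)
  have hδk : δ' ≤ (1 / (2 * (|N| + 1))) ^ 2 := (min_le_right _ _).trans (min_le_right _ _)
  have hg : Real.sqrt (-t) < r / 2 := sqrt_neg_lt_of_lt_sq hr2 (by linarith)
  have hk : Real.sqrt (-t) < 1 / (2 * (|N| + 1)) := sqrt_neg_lt_of_lt_sq hN1 (by linarith)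
  refine ⟨t, by linarith, ht2, ?_, lt_peak_of_sqrt_lt hσ hk⟩
  rw [norm_loudPath_add_peak, hft]
  linarith

/-! ### The LOUD kinematic package -/

/-- **The LOUD-DUST stub minus its Navier–Stokes clause has a kinematic counter-model**: the travelling
swirl along the loud path is a DIVERGENCE-FREE field `U` with `P = 0`, `G = ∇U`, satisfying (G) the weak
gradient on every `Q(a)`, (I) `𝐈(Q(a)) ≤ M` for all `a`, (D) `D ≤ 0`, (R) the rate with `C = 1`, (T) the
weakly null top, which has NO QUIET SHELL OF ANY RATIO `A₀ > 1`, and whose origin IS backward singular.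
Hence `stub_no_loudShellExtinctApex` (line `annulus-dichotomy`) cannot be proved from the kinematic
clauses and the quiet-shell exclusion of the package alone: given its hypothesis `hQA` at the class
`(M, 0, 1, A₀)`, LOUD with (sw) deleted from the outer package is false.  NOT a Navier–Stokes solution;
NS regularity is neither proved nor refuted by this. [folklore; AlbrittonBarker2019 §1; KNSS2009 (1.4)] -/
theorem exists_kinematic_loudShellExtinctApex :
    ∃ (U : ℝ → EuclideanSpace ℝ (Fin 3) → EuclideanSpace ℝ (Fin 3))
      (P : ℝ → EuclideanSpace ℝ (Fin 3) → ℝ)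
      (G : ℝ → EuclideanSpace ℝ (Fin 3) → EuclideanSpace ℝ (Fin 3) →L[ℝ] EuclideanSpace ℝ (Fin 3))
      (M D₀ : ℝ≥0) (C : ℝ),
      (∀ a : ℝ, 0 < a →
        HasWeakSpatialGradientOn
          (parabolicCylinderOpens a (0 : ℝ × EuclideanSpace ℝ (Fin 3))) U G) ∧
      (∀ a : ℝ, 0 < a →
        typeIBound (parabolicCylinder a (0 : ℝ × EuclideanSpace ℝ (Fin 3))) U P G ≤ M) ∧
      (∀ z₀ : ℝ × EuclideanSpace ℝ (Fin 3), z₀.1 ≤ 0 → ∀ r : ℝ, 0 < r → cknD r z₀ P ≤ D₀) ∧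
      (∀ s : ℝ, s < 0 → ∀ᵐ y : EuclideanSpace ℝ (Fin 3), ‖U s y‖ ≤ C / Real.sqrt (-s)) ∧
      (∀ φ : EuclideanSpace ℝ (Fin 3) → EuclideanSpace ℝ (Fin 3), ContDiff ℝ (⊤ : ℕ∞) φ →
        HasCompactSupport φ → ∀ ε : ℝ, 0 < ε →
        ∃ s₀ : ℝ, s₀ < 0 ∧ ∀ᵐ s ∂(volume.restrict (Ioo s₀ 0)), |∫ y, ⟪U s y, φ y⟫| ≤ ε) ∧
      (∀ A₀ : ℝ, 1 < A₀ → ¬ ∃ δ : ℝ, 0 < δ ∧ ∃ R : ℝ, 0 < R ∧ ∃ K : ℝ,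
        ∀ᵐ z ∂(volume.restrict
          (Ioo (-δ) 0 ×ˢ {y : EuclideanSpace ℝ (Fin 3) | R < ‖y‖ ∧ ‖y‖ < A₀ * R})),
            ‖U z.1 z.2‖ ≤ K) ∧
      IsBackwardSingularPoint U (0 : ℝ × EuclideanSpace ℝ (Fin 3)) ∧
      (∀ t : ℝ, ∀ x : EuclideanSpace ℝ (Fin 3), VectorCalculus.divergence (U t) x = 0) := by
  obtain ⟨M, hM⟩ := typeIBound_swirlTravel_cylinder_le (contDiffOn_loudPath (n := 1))
  refine ⟨swirlTravel loudPath, 0, swirlTravelGradient loudPath, M, 0, 1,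
    fun a _ => swirlTravel_hasWeakSpatialGradientOn (contDiffOn_loudPath (n := 1)) a,
    fun a _ => hM a, fun z₀ _ r _ => (cknD_zero r z₀).le, swirlTravel_rate loudPath,
    swirlTravel_nullTop loudPath, fun A₀ hA => ?_, swirlLoud_isBackwardSingularPoint,
    divergence_swirlTravel loudPath⟩
  rintro ⟨δ, hδ, R, hR, K, h⟩
  exact swirlLoud_isLoud hA δ hδ R hR K h


end Summit.NavierStokesRegularity.NavierStokesRegularity.Theorems.TypeITraceScarL3.Negative

end
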